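import Literature.NumberTheory.EllipticCurves.ThreeDivisionFieldSwanProofs
import Literature.NumberTheory.EllipticCurves.ThreeTorsionRadicalProofs
import Literature.NumberTheory.EllipticCurves.ThreeTorsionRadicalsProofs
import Literature.NumberTheory.GaloisRepresentations.NewtonOneSlopeOrdProofs
import HarnessLib

/-!
# The break of the central involution of `K(E[3])/K(x(E[3]))` from a "fake point"

`Proofs` file (theorems only, no definitions, no named facts) in topic
`NumberTheory/EllipticCurves`, landed by the seat of bsd.S15
(`Literature.NumberTheory.EllipticCurves.conductorNorm_eq_artinConductorNat_of_isElliptic`): the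
Galois side of Ogg's formula above `2` (Silverman *ATAEC* Thm. IV.11.1, `p = 2`, PDF p. 366) in
the form used for the non-abelian curves `j ≠ 0, 1728`.

Let `L = K(E[3]) ⊇ E = K(x(E[3]))`, `𝔓 ∣ 2` a prime of `\bar ℤ_K`, `ι` the central involution
of `Gal(L/K)` (acting as `-1` on `E[3]`, `exists_central_involution_divisionField_three`), and
write the four `x`-coordinates of `E[3] ∖ 0` through the radicals of
`ThreeTorsionRadicalProofs`: `12 x_ε + b₂ = ε₀R₀ + ε₁R₁ + ε₂R₂` (`ε` even), `R_i² = c₄ - 12 ζ^i δ`,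
`δ³ = Δ`, `R₀R₁R₂ = c₆`; put `X_ε := 3(ε₀R₀ + ε₁R₁ + ε₂R₂) = 36 x_ε + 3 b₂`, so that
`X³ - 27 c₄ X - 54 c₆ = (108 (2y + a₁x + a₃))²` on `E` (the `c₄, c₆`-model).  A **fake point** is a
polynomial `P ∈ 𝓞_K[X]` and a constant `c ∈ 𝓞_K`; its test elements are
`Z_ε := P(X_ε)² - c² (X_ε³ - 27 c₄ X_ε - 54 c₆) ∈ S_E`.  If `v_{𝔓_E}(Z) = n` is a unit residue
(`n` odd), `v_{𝔓_E}(X₁³ - 27c₄X₁ - 54c₆) = n₀`, `v_{𝔓_E}(2c) = κ` and `v_{𝔓_E}(Z_j - Z) = m_j`, then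

* `card_mul_swanConductorAt_torsion_three_eq_of_fakePoint` —
  **`#Q₀ · Sw_𝔓(E[3]) = 2 ((2κ + n₀ - n) + Σ_{j=2}^{4} (m_j - n))`** for quaternion wild inertia
  `#Q₁(𝔓 ∩ E) = 4`;
* `ord_comap_ringEquiv_eq` — transport of `v_𝔓` along a ring isomorphism (bookkeeping).

Proof: in `S_L` put `w := c · 108(2y₁ + a₁x₁ + a₃)` and `s := P(X₁)`; then `ι w = -w`, `ι s = s`,
`w² - s² = -Z`, and `v_{𝔓_L} = 2 v_{𝔓_E}` on `S_E` (`e(𝔓_L | 𝔓_E) = #(T ∩ Gal(L/E)) = #{1, ι} = 2`,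
Serre *Local Fields* I §7 Prop. 21–22), so `v_{𝔓_L}(2w) = 2κ + n₀`, `v_{𝔓_L}(w² - s²) = 2n` and
`lowerIndex_eq_of_smul_eq_neg_of_ord_sq_sub_sq` (Serre IV §1 Lemma 1, §2 Prop. 5) gives the break
`i_G(ι) - 1 = 2κ + n₀ - n`; then
`card_mul_swanConductorAt_torsion_three_eq_of_roots_divisionPolynomial_three`
(`ThreeDivisionFieldSwanProofs`).  The copy `IntermediateField.restrict` of `E` inside `L` and
`AlgEquiv.mapIntegralClosure` transport `S_E` into `S_L`.

Instance convention: in this file `Algebra (𝓞 K) ↥F` (`F ⊆ K̄` an intermediate field) and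
`Algebra (𝓞 K) K̄` are the restriction-of-scalars instances `IntermediateField.algebra'`,
`AlgebraicClosure.instAlgebra` used by the generic `R`-based API (`integralClosureToAbsIntegers`,
`RamificationGalois`); they are definitionally equal to `NumberField.RingOfIntegers.instAlgebra`
(cf. `ArtinConductorInductionProofs`).

## References
* J.-P. Serre, *Local Fields*, GTM 67, Springer 1979, Ch. I §7 Prop. 21–22, Ch. IV §1–§2.
* J. H. Silverman, *Advanced Topics in the Arithmetic of Elliptic Curves*, GTM 151, Springer 1994,
  Ch. IV §10–§11 (Ogg's formula, Thm. 11.1). [cite: SilvermanATAEC1994, Thm. IV.11.1]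
-/

noncomputable section

open scoped Classical NumberField
open Field IsDedekindDomain Polynomial

namespace Literature.NumberTheory.EllipticCurves

open Literature.NumberTheory.GaloisRepresentations

/-- Transport of `v_𝔓` along a ring isomorphism: `v_{e⁻¹𝔔}(x) = v_𝔔(e x)` (cf.
`InertiaFieldLayer.ord_comap_intermediate`). [folklore] -/
theorem ord_comap_ringEquiv_eq {B₁ B₂ : Type*} [CommRing B₁] [IsDedekindDomain B₁] [CommRing B₂]
    [IsDedekindDomain B₂] (e : B₁ ≃+* B₂)
    (Q : Ideal B₂) (x : B₁) :
    ord (Q.comap (e : B₁ →+* B₂)) x = ord Q (e x) := by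
  have hJ : ((Q.comap (e : B₁ →+* B₂)).map (e : B₁ →+* B₂)) = Q :=
    Ideal.map_comap_of_surjective _ e.surjective _
  have hmem : ∀ n : ℕ, (n : ℕ∞) ≤ ord (Q.comap (e : B₁ →+* B₂)) x ↔ (n : ℕ∞) ≤ ord Q (e x) := by
    intro n
    rw [← mem_pow_iff_le_ord, ← mem_pow_iff_le_ord]
    conv_rhs => rw [← hJ, ← Ideal.map_pow, Ideal.map_comap_of_equiv, Ideal.mem_comap,
      RingEquiv.symm_apply_apply]
  apply le_antisymm
  · rw [← ENat.forall_natCast_le_iff_le]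
    intro n hn
    exact (hmem n).mp hn
  · rw [← ENat.forall_natCast_le_iff_le]
    intro n hn
    exact (hmem n).mpr hn

end Literature.NumberTheory.EllipticCurves

namespace WeierstrassCurve

open Literature.NumberTheory.EllipticCurves Literature.NumberTheory.GaloisRepresentations

attribute [local instance] AddSubgroup.torsionBy.zmodModule

/- `Algebra (𝓞 K) ↥E` for an intermediate field `E ⊆ K̄` must be the restriction-of-scalars
instance `IntermediateField.algebra'` used by the generic `R`-based API of the tree
(`integralClosureToAbsIntegers`, `RamificationGalois`), not `NumberField.RingOfIntegers.instAlgebra`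
(the two are definitionally, but not reducibly, equal); cf. `ArtinConductorInductionProofs`. -/
attribute [local instance 1001] IntermediateField.algebra'
attribute [local instance 1002] AlgebraicClosure.instAlgebra


variable {K : Type} [Field K] [NumberField K] (W : WeierstrassCurve K)


set_option maxHeartbeats 1600000 in
set_option synthInstance.maxHeartbeats 400000 in
/-- **`#Q₀ · Sw_𝔓(E[3]) = 2 ((2κ + n₀ - n) + Σ_j (m_j - n))` from a fake point.**  `K` a number
field, `v ∣ 2`, `3 ∉ v`, `𝔓 ∣ v` a prime of `\bar ℤ_K`; radicals `ζ, δ, R₀, R₁, R₂` of `E[3]`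
(`ζ² + ζ + 1 = 0`, `δ³ = Δ`, `R_i² = c₄ - 12ζ^iδ`, `R₀R₁R₂ = c₆`); `K(E[3])` wildly ramified at `𝔓`
and `#Q₁(𝔓 ∩ K(x(E[3]))) = 4`; a fake point `(P, c)` with test elements
`Z_ε = P(X_ε)² - c²(X_ε³ - 27c₄X_ε - 54c₆)`, `X_ε = 3(±R₀ ± R₁ ± R₂)` (even signs), in
`S_E = integralClosure 𝓞_K K(x(E[3]))`, and `x`-level valuations `v(Z) = n` with `n` a unit mod `𝔓`,
`v(X₁³ - 27c₄X₁ - 54c₆) = n₀`, `v(2c) = κ`, `v(Z_j - Z) = m_j` (`m_j - n ≤ 2κ + n₀ - n`).  Then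
`#Q₀(𝔓 ∩ K(x(E[3]))) · Sw_𝔓(E[3]) = 2 ((2κ + n₀ - n) + Σ_{j=2}^4 (m_j - n))`.
The break of the central involution `ι` is `2κ + n₀ - n` (Kummer element
`w = c · 108(2y₁ + a₁x₁ + a₃)`, `w² - P(X₁)² = -Z` in `S_{K(E[3])}`, `v_{𝔓_L} = 2v_{𝔓_E}` on `S_E`).
Ref: Serre, *Local Fields*, Ch. IV §1 Lemma 1, §2 Prop. 5, Ch. I §7 Prop. 22; Silverman *ATAEC*
Thm. IV.11.1 (the quantity computed is the wild part `δ_𝔓` of Ogg's formula at `p = 2`).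
[cite: SerreLocalFields1979, Ch. IV §1–§2] [cite: SilvermanATAEC1994, Thm. IV.11.1] -/
theorem card_mul_swanConductorAt_torsion_three_eq_of_fakePoint [W.IsElliptic]
    {v : HeightOneSpectrum (𝓞 K)} (hv2 : (2 : 𝓞 K) ∈ v.asIdeal) (h3 : ((3 : ℕ) : 𝓞 K) ∉ v.asIdeal)
    {𝔓 : Ideal (absIntegers (𝓞 K) K)} (h𝔓 : 𝔓 ∈ v.primesAbove)
    -- radical data
    {ζ δ R₀ R₁ R₂ : AlgebraicClosure K} (hζ : ζ ^ 2 + ζ + 1 = 0)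
    (hδ : δ ^ 3 = algebraMap K (AlgebraicClosure K) W.Δ)
    (h₀ : R₀ ^ 2 = algebraMap K (AlgebraicClosure K) W.c₄ - 12 * δ)
    (h₁ : R₁ ^ 2 = algebraMap K (AlgebraicClosure K) W.c₄ - 12 * ζ * δ)
    (h₂ : R₂ ^ 2 = algebraMap K (AlgebraicClosure K) W.c₄ - 12 * ζ ^ 2 * δ)
    (hρ : R₀ * R₁ * R₂ = algebraMap K (AlgebraicClosure K) W.c₆)
    -- wild ramification of `K(E[3])` and quaternion wild inertia of `K(x(E[3]))`
    (hne : (𝔓.comap ((W.divisionField 3).integralClosureToAbsIntegers (𝓞 K))).ramificationSubgroup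
      (W.divisionField 3 ≃ₐ[K] W.divisionField 3) 1 ≠ ⊥)
    (hcard : Nat.card ((𝔓.comap ((W.xDivisionField 3).integralClosureToAbsIntegers (𝓞 K))).ramificationSubgroup
      (W.xDivisionField 3 ≃ₐ[K] W.xDivisionField 3) 1) = 4)
    -- the fake point: Z = P(X₁)² - c² (X₁³ - 27 c₄ X₁ - 54 c₆), X_i = 3 S_i, as elements of S_x
    {Z Z₂ Z₃ Z₄ Y₀ : integralClosure (𝓞 K) (W.xDivisionField 3)} {P : Polynomial (𝓞 K)} {c : 𝓞 K}
    (hZ : ((Z : W.xDivisionField 3) : AlgebraicClosure K) =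
      (P.map (algebraMap (𝓞 K) (AlgebraicClosure K))).eval (3 * (R₀ + R₁ + R₂)) ^ 2 -
        algebraMap (𝓞 K) (AlgebraicClosure K) c ^ 2 * ((3 * (R₀ + R₁ + R₂)) ^ 3 - 27 * algebraMap K _ W.c₄ * (3 * (R₀ + R₁ + R₂))
          - 54 * algebraMap K _ W.c₆))
    (hZ₂ : ((Z₂ : W.xDivisionField 3) : AlgebraicClosure K) =
      (P.map (algebraMap (𝓞 K) (AlgebraicClosure K))).eval (3 * (R₀ - R₁ - R₂)) ^ 2 -
        algebraMap (𝓞 K) (AlgebraicClosure K) c ^ 2 * ((3 * (R₀ - R₁ - R₂)) ^ 3 - 27 * algebraMap K _ W.c₄ * (3 * (R₀ - R₁ - R₂))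
          - 54 * algebraMap K _ W.c₆))
    (hZ₃ : ((Z₃ : W.xDivisionField 3) : AlgebraicClosure K) =
      (P.map (algebraMap (𝓞 K) (AlgebraicClosure K))).eval (3 * (-R₀ + R₁ - R₂)) ^ 2 -
        algebraMap (𝓞 K) (AlgebraicClosure K) c ^ 2 * ((3 * (-R₀ + R₁ - R₂)) ^ 3 - 27 * algebraMap K _ W.c₄ * (3 * (-R₀ + R₁ - R₂))
          - 54 * algebraMap K _ W.c₆))
    (hZ₄ : ((Z₄ : W.xDivisionField 3) : AlgebraicClosure K) =
      (P.map (algebraMap (𝓞 K) (AlgebraicClosure K))).eval (3 * (-R₀ - R₁ + R₂)) ^ 2 -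
        algebraMap (𝓞 K) (AlgebraicClosure K) c ^ 2 * ((3 * (-R₀ - R₁ + R₂)) ^ 3 - 27 * algebraMap K _ W.c₄ * (3 * (-R₀ - R₁ + R₂))
          - 54 * algebraMap K _ W.c₆))
    (hY₀ : ((Y₀ : W.xDivisionField 3) : AlgebraicClosure K) =
      (3 * (R₀ + R₁ + R₂)) ^ 3 - 27 * algebraMap K _ W.c₄ * (3 * (R₀ + R₁ + R₂)) - 54 * algebraMap K _ W.c₆)
    {s₀ : integralClosure (𝓞 K) (W.xDivisionField 3)}
    (hs₀ : ((s₀ : W.xDivisionField 3) : AlgebraicClosure K) =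
      (P.map (algebraMap (𝓞 K) (AlgebraicClosure K))).eval (3 * (R₀ + R₁ + R₂)))
    -- x-level valuation data
    {n n₀ κ m₂ m₃ m₄ : ℕ}
    (hn : ord (𝔓.comap ((W.xDivisionField 3).integralClosureToAbsIntegers (𝓞 K))) Z = n)
    (hnu : (n : integralClosure (𝓞 K) (W.xDivisionField 3)) ∉
      𝔓.comap ((W.xDivisionField 3).integralClosureToAbsIntegers (𝓞 K)))
    (hn₀ : ord (𝔓.comap ((W.xDivisionField 3).integralClosureToAbsIntegers (𝓞 K))) Y₀ = n₀)
    (hκ : ord (𝔓.comap ((W.xDivisionField 3).integralClosureToAbsIntegers (𝓞 K)))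
      (algebraMap (𝓞 K) (integralClosure (𝓞 K) (W.xDivisionField 3)) (2 * c)) = κ)
    (hm₂ : ord (𝔓.comap ((W.xDivisionField 3).integralClosureToAbsIntegers (𝓞 K))) (Z₂ - Z) = m₂)
    (hm₃ : ord (𝔓.comap ((W.xDivisionField 3).integralClosureToAbsIntegers (𝓞 K))) (Z₃ - Z) = m₃)
    (hm₄ : ord (𝔓.comap ((W.xDivisionField 3).integralClosureToAbsIntegers (𝓞 K))) (Z₄ - Z) = m₄)
    (hm₂b : m₂ - n ≤ 2 * κ + n₀ - n) (hm₃b : m₃ - n ≤ 2 * κ + n₀ - n) (hm₄b : m₄ - n ≤ 2 * κ + n₀ - n) :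
    (Nat.card ((𝔓.comap ((W.xDivisionField 3).integralClosureToAbsIntegers (𝓞 K))).ramificationSubgroup
        (W.xDivisionField 3 ≃ₐ[K] W.xDivisionField 3) 0) : ℝ) *
        (W.torsionGaloisRep 3).swanConductorAt (𝓞 K) 𝔓 =
      2 * ((2 * κ + n₀ - n : ℕ) + (((m₂ - n) + (m₃ - n) + (m₄ - n) : ℕ) : ℝ)) := by
  classical
  haveI : Fact (Nat.Prime 3) := ⟨Nat.prime_three⟩
  -- `2, 3 ≠ 0` in `K` and `K̄`
  have h2K : (2 : K) ≠ 0 := two_ne_zero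
  have h3K : (3 : K) ≠ 0 := three_ne_zero
  have h2 : (2 : AlgebraicClosure K) ≠ 0 := two_ne_zero
  have h3' : (3 : AlgebraicClosure K) ≠ 0 := three_ne_zero
  have h12 : (12 : AlgebraicClosure K) ≠ 0 := by norm_num
  -- the involution `ι`
  obtain ⟨ι, hι1, hιne, hιsq, hι⟩ := W.exists_central_involution_divisionField_three hv2 h3 h𝔓 hne
  -- invariants of the base change
  obtain ⟨eb₂, ec₄, ec₆, eΔ⟩ := W.baseChange_algebraicClosure_invariants
  set W' := W.baseChange (AlgebraicClosure K) with hW'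
  have h₀' : R₀ ^ 2 = W'.c₄ - 12 * δ := by rw [ec₄]; exact h₀
  have h₁' : R₁ ^ 2 = W'.c₄ - 12 * ζ * δ := by rw [ec₄]; exact h₁
  have h₂' : R₂ ^ 2 = W'.c₄ - 12 * ζ ^ 2 * δ := by rw [ec₄]; exact h₂
  have hρ' : R₀ * R₁ * R₂ = W'.c₆ := by rw [ec₆]; exact hρ
  have hδ0 : δ ≠ 0 := by
    intro h0
    rw [h0, zero_pow three_ne_zero] at hδ
    exact W.isUnit_Δ.ne_zero ((_root_.map_eq_zero_iff _ (algebraMap K (AlgebraicClosure K)).injective).mp hδ.symm)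
  -- the four roots
  set b₂' : AlgebraicClosure K := algebraMap K (AlgebraicClosure K) W.b₂ with hb₂'
  set x₁ : AlgebraicClosure K := (-b₂' + R₀ + R₁ + R₂) / 12 with hx₁def
  set x₂ : AlgebraicClosure K := (-b₂' + R₀ - R₁ - R₂) / 12 with hx₂def
  set x₃ : AlgebraicClosure K := (-b₂' - R₀ + R₁ - R₂) / 12 with hx₃def
  set x₄ : AlgebraicClosure K := (-b₂' - R₀ - R₁ + R₂) / 12 with hx₄def
  have hx₁ : 12 * x₁ = -W'.b₂ + R₀ + R₁ + R₂ := by rw [eb₂, hx₁def]; field_simp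
  have hx₂ : 12 * x₂ = -W'.b₂ + R₀ - R₁ - R₂ := by rw [eb₂, hx₂def]; field_simp
  have hx₃ : 12 * x₃ = -W'.b₂ - R₀ + R₁ - R₂ := by rw [eb₂, hx₃def]; field_simp
  have hx₄ : 12 * x₄ = -W'.b₂ - R₀ - R₁ + R₂ := by rw [eb₂, hx₄def]; field_simp
  have hΨ : W'.Ψ₃.roots = {x₁, x₂, x₃, x₄} :=
    W'.roots_Ψ₃_eq_of_radical h2 h3' hζ hδ0 h₀' h₁' h₂' hρ' hx₁ hx₂ hx₃ hx₄
  have hnd := W'.radical_roots_nodup h2 h3' hζ hδ0 h₀' h₁' h₂' hx₁ hx₂ hx₃ hx₄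
  simp only [Multiset.insert_eq_cons, Multiset.nodup_cons, Multiset.mem_cons,
    Multiset.mem_singleton, Multiset.nodup_singleton, and_true, not_or] at hnd
  obtain ⟨⟨ne12, ne13, ne14⟩, ⟨ne23, ne24⟩, ne34⟩ := hnd
  -- `X_i = 36 x_i + 3 b₂ = 3 S_i`
  have hX₁ : 3 * (R₀ + R₁ + R₂) = 36 * x₁ + 3 * b₂' := by rw [hx₁def]; field_simp; ring
  have hX₂ : 3 * (R₀ - R₁ - R₂) = 36 * x₂ + 3 * b₂' := by rw [hx₂def]; field_simp; ring
  have hX₃ : 3 * (-R₀ + R₁ - R₂) = 36 * x₃ + 3 * b₂' := by rw [hx₃def]; field_simp; ring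
  have hX₄ : 3 * (-R₀ - R₁ + R₂) = 36 * x₄ + 3 * b₂' := by rw [hx₄def]; field_simp; ring
  -- the `Z`'s as polynomial values at `36 x_i + 3 b₂`
  set Qp : Polynomial K := (P.map (algebraMap (𝓞 K) K)) ^ 2 -
    Polynomial.C ((algebraMap (𝓞 K) K c) ^ 2) * (Polynomial.X ^ 3 - Polynomial.C (27 * W.c₄) * Polynomial.X
      - Polynomial.C (54 * W.c₆)) with hQp
  have hQpeval : ∀ t : AlgebraicClosure K, Polynomial.aeval t Qp =
      (P.map (algebraMap (𝓞 K) (AlgebraicClosure K))).eval t ^ 2 -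
        algebraMap (𝓞 K) (AlgebraicClosure K) c ^ 2 *
          (t ^ 3 - 27 * algebraMap K _ W.c₄ * t - 54 * algebraMap K _ W.c₆) := by
    intro t
    rw [Polynomial.eval_map, ← Polynomial.aeval_def]
    simp only [hQp, map_sub, map_mul, map_pow, Polynomial.aeval_C, Polynomial.aeval_X,
      Polynomial.aeval_map_algebraMap, map_ofNat]
    rw [← IsScalarTower.algebraMap_apply (𝓞 K) K (AlgebraicClosure K) c]
  have hsmul : ∀ (σ : absoluteGaloisGroup K) (t : AlgebraicClosure K),
      σ • Polynomial.aeval t Qp = Polynomial.aeval (σ • t) Qp := by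
    intro σ t
    let σ' : AlgebraicClosure K ≃ₐ[K] AlgebraicClosure K := σ
    change σ' (Polynomial.aeval t Qp) = Polynomial.aeval (σ' t) Qp
    rw [← AlgEquiv.coe_toAlgHom, ← Polynomial.aeval_algHom_apply]
  have hZa : ((Z : W.xDivisionField 3) : AlgebraicClosure K) = Polynomial.aeval (36 * x₁ + 3 * b₂') Qp := by
    rw [hQpeval, ← hX₁]; exact hZ
  have hZa₂ : ((Z₂ : W.xDivisionField 3) : AlgebraicClosure K) = Polynomial.aeval (36 * x₂ + 3 * b₂') Qp := by
    rw [hQpeval, ← hX₂]; exact hZ₂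
  have hZa₃ : ((Z₃ : W.xDivisionField 3) : AlgebraicClosure K) = Polynomial.aeval (36 * x₃ + 3 * b₂') Qp := by
    rw [hQpeval, ← hX₃]; exact hZ₃
  have hZa₄ : ((Z₄ : W.xDivisionField 3) : AlgebraicClosure K) = Polynomial.aeval (36 * x₄ + 3 * b₂') Qp := by
    rw [hQpeval, ← hX₄]; exact hZ₄
  -- conjugation of the `Z`'s
  have hnumσ : ∀ (σ : absoluteGaloisGroup K) (m : ℕ), σ • ((m : AlgebraicClosure K)) = m := fun σ m ↦ by
    rw [show ((m : AlgebraicClosure K)) = algebraMap K (AlgebraicClosure K) m from (map_natCast _ m).symm]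
    exact smul_algebraMap σ (m : K)
  have hconj : ∀ (σ : absoluteGaloisGroup K) (xj : AlgebraicClosure K)
      (Zj : integralClosure (𝓞 K) (W.xDivisionField 3)),
      σ • x₁ = xj → ((Zj : W.xDivisionField 3) : AlgebraicClosure K) = Polynomial.aeval (36 * xj + 3 * b₂') Qp →
      σ • ((Z : W.xDivisionField 3) : AlgebraicClosure K) = ((Zj : W.xDivisionField 3) : AlgebraicClosure K) := by
    intro σ xj Zj hσ hZj
    rw [hZa, hZj, hsmul]
    congr 1
    rw [smul_add, smul_mul', smul_mul', hσ, hb₂', smul_algebraMap]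
    have e36 := hnumσ σ 36
    have e3 := hnumσ σ 3
    push_cast at e36 e3
    rw [e36, e3]
  -- the break of `ι`
  have hb : lowerIndex (𝔓.comap ((W.divisionField 3).integralClosureToAbsIntegers (𝓞 K)))
      (W.divisionField 3 ≃ₐ[K] W.divisionField 3) ι = ((2 * κ + n₀ - n : ℕ) : ℕ∞) + 1 := by
    have hle : W.xDivisionField 3 ≤ W.divisionField 3 := W.xDivisionField_le_divisionField 3
    -- instances (cf. `ThreeTorsionWildInertiaRootsProofs`)
    haveI hDDF : IsDedekindDomain (integralClosure (𝓞 K) (W.divisionField 3)) := integralClosure.isDedekindDomain (𝓞 K) K (W.divisionField 3)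
    haveI hDDE : IsDedekindDomain (integralClosure (𝓞 K) (W.xDivisionField 3)) := integralClosure.isDedekindDomain (𝓞 K) K (W.xDivisionField 3)
    haveI : 𝔓.IsPrime := h𝔓.1
    haveI h𝔓max : 𝔓.IsMaximal := HeightOneSpectrum.isMaximal_of_mem_primesAbove h𝔓
    haveI : IsGalois K (W.divisionField 3) := {}
    haveI : IsGalois K (W.xDivisionField 3) := {}
    haveI hPFmax : (𝔓.comap ((W.divisionField 3).integralClosureToAbsIntegers (𝓞 K))).IsMaximal := isMaximal_comap_integralClosureToAbsIntegers (𝓞 K) 𝔓 (W.divisionField 3)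
    haveI hPEmax : (𝔓.comap ((W.xDivisionField 3).integralClosureToAbsIntegers (𝓞 K))).IsMaximal := isMaximal_comap_integralClosureToAbsIntegers (𝓞 K) 𝔓 (W.xDivisionField 3)
    have hunderF : (𝔓.comap ((W.divisionField 3).integralClosureToAbsIntegers (𝓞 K))).under (𝓞 K) = v.asIdeal := by
      rw [under_comap_integralClosureToAbsIntegers, ← h𝔓.2.over]
    have hunderE : (𝔓.comap ((W.xDivisionField 3).integralClosureToAbsIntegers (𝓞 K))).under (𝓞 K) = v.asIdeal := by
      rw [under_comap_integralClosureToAbsIntegers, ← h𝔓.2.over]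
    have hPF0 : (𝔓.comap ((W.divisionField 3).integralClosureToAbsIntegers (𝓞 K))) ≠ ⊥ := by
      intro h0
      have hinj : Function.Injective (algebraMap (𝓞 K) (integralClosure (𝓞 K) (W.divisionField 3))) :=
        (faithfulSMul_iff_algebraMap_injective _ _).mp
          (faithfulSMul_integralClosure (𝓞 K) (K := K) (L := (W.divisionField 3)))
      have h2' : (2 : 𝓞 K) ∈ (𝔓.comap ((W.divisionField 3).integralClosureToAbsIntegers (𝓞 K))).under (𝓞 K) := by rw [hunderF]; exact hv2
      rw [Ideal.under_def, Ideal.mem_comap, h0, Ideal.mem_bot] at h2'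
      exact two_ne_zero (hinj (h2'.trans (map_zero _).symm))
    have hPE0 : (𝔓.comap ((W.xDivisionField 3).integralClosureToAbsIntegers (𝓞 K))) ≠ ⊥ := by
      intro h0
      have hinj : Function.Injective (algebraMap (𝓞 K) (integralClosure (𝓞 K) (W.xDivisionField 3))) :=
        (faithfulSMul_iff_algebraMap_injective _ _).mp
          (faithfulSMul_integralClosure (𝓞 K) (K := K) (L := (W.xDivisionField 3)))
      have h2' : (2 : 𝓞 K) ∈ (𝔓.comap ((W.xDivisionField 3).integralClosureToAbsIntegers (𝓞 K))).under (𝓞 K) := by rw [hunderE]; exact hv2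
      rw [Ideal.under_def, Ideal.mem_comap, h0, Ideal.mem_bot] at h2'
      exact two_ne_zero (hinj (h2'.trans (map_zero _).symm))
    haveI hfinqF : Finite (integralClosure (𝓞 K) (W.divisionField 3) ⧸ (𝔓.comap ((W.divisionField 3).integralClosureToAbsIntegers (𝓞 K)))) := by
      have hmodfin : Module.Finite (𝓞 K) (integralClosure (𝓞 K) (W.divisionField 3)) :=
        IsIntegralClosure.finite (𝓞 K) K (W.divisionField 3) (integralClosure (𝓞 K) (W.divisionField 3))
      haveI hlies : (𝔓.comap ((W.divisionField 3).integralClosureToAbsIntegers (𝓞 K))).LiesOver (𝔓.under (𝓞 K)) :=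
        ⟨(under_comap_integralClosureToAbsIntegers (𝓞 K) 𝔓 (W.divisionField 3)).symm⟩
      haveI : Finite ((𝓞 K) ⧸ 𝔓.under (𝓞 K)) := by
        rw [← h𝔓.2.over]; exact Ideal.finiteQuotientOfFreeOfNeBot v.asIdeal v.ne_bot
      haveI : Module.Finite ((𝓞 K) ⧸ 𝔓.under (𝓞 K)) (integralClosure (𝓞 K) (W.divisionField 3) ⧸ (𝔓.comap ((W.divisionField 3).integralClosureToAbsIntegers (𝓞 K)))) :=
        @module_finite_of_liesOver (𝓞 K) (integralClosure (𝓞 K) (W.divisionField 3)) _ _ _ (𝔓.comap ((W.divisionField 3).integralClosureToAbsIntegers (𝓞 K))) (𝔓.under (𝓞 K)) hlies hmodfin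
      exact Module.finite_of_finite ((𝓞 K) ⧸ 𝔓.under (𝓞 K))
    -- the `3`-torsion point above `x₁`
    have e₁ : 12 * x₁ = -algebraMap K (AlgebraicClosure K) W.b₂ + 1 * R₀ + 1 * R₁ + 1 * R₂ := by
      rw [← hb₂', ← eb₂, hx₁]; ring
    obtain ⟨T₁, y₁, hns₁, hT₁⟩ := W.exists_geomTorsion_three_eq_some_of_radical h2K h3K hζ h₀ h₁ h₂ hρ
      (Or.inl rfl) (Or.inl rfl) (Or.inl rfl) (by norm_num) e₁
    -- coordinates in `F = K(E[3])` and the Kummer element `w = 108 (2y₁ + a₁x₁ + a₃)`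
    obtain ⟨hx₁F, hy₁F⟩ := W.mem_divisionField_of_eq_some 3 hT₁
    have ha₁ : W'.a₁ = algebraMap K (AlgebraicClosure K) W.a₁ := rfl
    have ha₃ : W'.a₃ = algebraMap K (AlgebraicClosure K) W.a₃ := rfl
    set wval : AlgebraicClosure K := 108 * (2 * y₁ + W'.a₁ * x₁ + W'.a₃) with hwval
    have hwsq : wval ^ 2 = ((Y₀ : W.xDivisionField 3) : AlgebraicClosure K) := by
      have h1 := W'.sq_two_mul_add_eq_of_equation hns₁.left
      have h2 := W'.mul_Ψ₂Sq_eval_eq x₁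
      rw [hY₀, hX₁, hwval, ← eb₂, ← ec₄, ← ec₆]
      linear_combination (11664 : AlgebraicClosure K) * h1 + 27 * h2
    have hwF : wval ∈ W.divisionField 3 := by
      rw [hwval, ha₁, ha₃]
      refine mul_mem (by exact_mod_cast (W.divisionField 3).natCast_mem 108) ?_
      refine add_mem (add_mem (mul_mem (by exact_mod_cast (W.divisionField 3).natCast_mem 2) hy₁F)
        (mul_mem ((W.divisionField 3).algebraMap_mem _) hx₁F)) ((W.divisionField 3).algebraMap_mem _)
    -- the element of `S_F` and its square
    have hY₀int : _root_.IsIntegral (𝓞 K) (⟨wval, hwF⟩ : W.divisionField 3) := by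
      have hsq : (⟨wval, hwF⟩ : W.divisionField 3) ^ 2 =
          IntermediateField.inclusion hle (Y₀ : W.xDivisionField 3) := by
        apply Subtype.ext
        change wval ^ 2 = ((Y₀ : W.xDivisionField 3) : AlgebraicClosure K)
        exact hwsq
      refine _root_.IsIntegral.of_pow two_pos ?_
      rw [hsq]
      exact (Y₀.2).map (IntermediateField.inclusion hle)
    set w₀ : integralClosure (𝓞 K) (W.divisionField 3) := ⟨⟨wval, hwF⟩, hY₀int⟩ with hw₀
    -- the copy `(IntermediateField.restrict hle) = restrict hle` of `E` inside `F`, and the transfer `S_E ≃ S_{(IntermediateField.restrict hle)} → S_F`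
    letI algFr : Algebra (integralClosure (𝓞 K) (IntermediateField.restrict hle))
        (integralClosure (𝓞 K) (W.divisionField 3)) :=
      integralClosureAlgebra (𝓞 K) (IntermediateField.restrict hle)
    obtain ⟨eR, heR⟩ : ∃ eR : integralClosure (𝓞 K) (W.xDivisionField 3) ≃+* integralClosure (𝓞 K) (IntermediateField.restrict hle),
        eR = ((IntermediateField.restrict_algEquiv hle).restrictScalars (𝓞 K)).mapIntegralClosure.toRingEquiv := ⟨_, rfl⟩
    obtain ⟨𝔓Fr, h𝔓Fr⟩ : ∃ 𝔓Fr : Ideal (integralClosure (𝓞 K) (IntermediateField.restrict hle)),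
        𝔓Fr = @Ideal.under _ _ _ _ algFr (𝔓.comap ((W.divisionField 3).integralClosureToAbsIntegers (𝓞 K))) :=
      ⟨_, rfl⟩
    have hcomap : 𝔓Fr.comap (eR : integralClosure (𝓞 K) (W.xDivisionField 3) →+* integralClosure (𝓞 K) (IntermediateField.restrict hle)) =
        𝔓.comap ((W.xDivisionField 3).integralClosureToAbsIntegers (𝓞 K)) := by
      rw [h𝔓Fr, heR, Ideal.under_def]
      exact comap_restrict_mapIntegralClosure (𝓞 K) hle 𝔓
    have hjval : ∀ X : integralClosure (𝓞 K) (W.xDivisionField 3),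
        (((algebraMap (integralClosure (𝓞 K) (IntermediateField.restrict hle))
            (integralClosure (𝓞 K) (W.divisionField 3)) (eR X) : integralClosure (𝓞 K) (W.divisionField 3)) :
            W.divisionField 3) : AlgebraicClosure K) =
          ((X : W.xDivisionField 3) : AlgebraicClosure K) := fun X => by rw [heR]; rfl
    -- `v_{𝔓_F}(X) = e · v_{𝔓_E}(X)` for `X ∈ S_E`
    obtain ⟨e', he'⟩ : ∃ e' : ℕ, e' = @Ideal.ramificationIdx' _ _ _ _ algFr 𝔓Fr
        (𝔓.comap ((W.divisionField 3).integralClosureToAbsIntegers (𝓞 K))) := ⟨_, rfl⟩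
    have htr : ∀ X : integralClosure (𝓞 K) (W.xDivisionField 3),
        ord (𝔓.comap ((W.divisionField 3).integralClosureToAbsIntegers (𝓞 K)))
            (algebraMap (integralClosure (𝓞 K) (IntermediateField.restrict hle))
              (integralClosure (𝓞 K) (W.divisionField 3)) (eR X)) =
          e' * ord (𝔓.comap ((W.xDivisionField 3).integralClosureToAbsIntegers (𝓞 K))) X := by
      intro X
      haveI := hPFmax
      haveI : IsDedekindDomain (integralClosure (𝓞 K) (IntermediateField.restrict hle)) :=
        integralClosure.isDedekindDomain (𝓞 K) K (IntermediateField.restrict hle)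
      have hh := ord_algebraMap_integralClosure (𝓞 K) (IntermediateField.restrict hle) (K := K)
        (L := W.divisionField 3) _ hPF0 (eR X)
      have h3 := hcomap
      rw [h𝔓Fr] at h3
      have h4 := ord_comap_ringEquiv_eq eR
        (@Ideal.under _ _ _ _ algFr (𝔓.comap ((W.divisionField 3).integralClosureToAbsIntegers (𝓞 K)))) X
      refine hh.trans ?_
      rw [he', h𝔓Fr]
      congr 1
      exact h4.symm.trans (congrArg (fun Q => ord Q X) h3)
    -- the elements `s`, `w = c · w₀` of `S_F`
    set sF : integralClosure (𝓞 K) (W.divisionField 3) :=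
      algebraMap (integralClosure (𝓞 K) (IntermediateField.restrict hle)) (integralClosure (𝓞 K) (W.divisionField 3)) (eR s₀) with hsF
    set w : integralClosure (𝓞 K) (W.divisionField 3) := algebraMap (𝓞 K) _ c * w₀ with hw
    -- a lift `σ` of `ι` and its action on the coordinates
    obtain ⟨σ, hσ⟩ := absRestrictNormalHom_surjective' (W.divisionField 3) ι
    obtain ⟨hσx, hσy⟩ := W.smul_coord_of_smul_eq_neg (ℓ := 3) (hι σ hσ T₁) hT₁
    have hσw : σ • wval = -wval := by
      rw [hwval, smul_mul', smul_add, smul_add, smul_mul', smul_mul', hσx, hσy, ha₁, ha₃,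
        smul_algebraMap, smul_algebraMap]
      have e108 := hnumσ σ 108
      have e2 := hnumσ σ 2
      push_cast at e108 e2
      rw [e108, e2]
      ring
    have hresF : ∀ X : integralClosure (𝓞 K) (W.divisionField 3),
        (((ι • X : integralClosure (𝓞 K) (W.divisionField 3)) : W.divisionField 3) : AlgebraicClosure K) =
          σ • ((X : W.divisionField 3) : AlgebraicClosure K) := by
      intro X
      rw [integralClosure.coe_smul, ← hσ]
      exact AlgEquiv.restrictNormal_commutes (absoluteGaloisGroup.toAlgEquiv K σ) (W.divisionField 3) X
    have hinjF : ∀ {X Y : integralClosure (𝓞 K) (W.divisionField 3)},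
        ((X : W.divisionField 3) : AlgebraicClosure K) = ((Y : W.divisionField 3) : AlgebraicClosure K) → X = Y :=
      fun h => Subtype.ext (Subtype.ext h)
    have hιw : ι • w = -w := by
      apply hinjF
      rw [hresF, hw]
      push_cast
      rw [smul_mul']
      have hc' : ((algebraMap (𝓞 K) (W.divisionField 3) c : W.divisionField 3) : AlgebraicClosure K) =
          algebraMap K (AlgebraicClosure K) (algebraMap (𝓞 K) K c) := rfl
      have hw₀val : ((w₀ : W.divisionField 3) : AlgebraicClosure K) = wval := rfl
      rw [hc', smul_algebraMap, hw₀val, hσw, mul_neg]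
    -- `ι` fixes `E = K(x(E[3]))` pointwise, hence `s`
    have hσE : absRestrictNormalHom (W.xDivisionField 3) σ = 1 :=
      (W.absRestrictNormalHom_xDivisionField_eq_one_iff_divisionField hι σ).mpr (Or.inr hσ)
    have hfixE : ∀ e : W.xDivisionField 3, σ • (e : AlgebraicClosure K) = e := by
      intro e
      have key := AlgEquiv.restrictNormal_commutes (absoluteGaloisGroup.toAlgEquiv K σ) (W.xDivisionField 3) e
      change ((absRestrictNormalHom (W.xDivisionField 3) σ e : W.xDivisionField 3) : AlgebraicClosure K) = _ at key
      rw [hσE, AlgEquiv.one_apply] at key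
      exact key.symm
    have hιs : ι • sF = sF := by
      apply hinjF
      rw [hresF, hsF, hjval]
      exact hfixE _
    -- `e(𝔓_F | 𝔓_{F'}) = #(T ∩ Gal(F/F')) = #{1, ι} = 2`
    haveI : Normal K (IntermediateField.restrict hle) :=
      Normal.of_algEquiv (IntermediateField.restrict_algEquiv hle)
    have hkerE := W.absRestrictNormalHom_xDivisionField_eq_one_iff_divisionField hι
    have hker := restrictNormalHom_restrict_eq_one_iff (W.divisionField 3) (W.xDivisionField 3) hle hkerE
    have hH : ∀ g : W.divisionField 3 ≃ₐ[K] W.divisionField 3,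
        g ∈ (IntermediateField.restrict hle).fixingSubgroup ↔ g = 1 ∨ g = ι := by
      intro g
      rw [← IntermediateField.restrictNormalHom_ker, MonoidHom.mem_ker]
      exact hker g
    have hι0 : ι ∈ (𝔓.comap ((W.divisionField 3).integralClosureToAbsIntegers (𝓞 K))).ramificationSubgroup
        (W.divisionField 3 ≃ₐ[K] W.divisionField 3) 0 :=
      Ideal.ramificationSubgroup_antitone _ _ (Nat.zero_le 1) hι1
    have hιH : ι ∈ (IntermediateField.restrict hle).fixingSubgroup := (hH ι).mpr (Or.inr rfl)
    have hcardI : Nat.card ((𝔓.comap ((W.divisionField 3).integralClosureToAbsIntegers (𝓞 K))).inertia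
        (IntermediateField.restrict hle).fixingSubgroup) = 2 := by
      have hset : ∀ x : (IntermediateField.restrict hle).fixingSubgroup,
          x ∈ (𝔓.comap ((W.divisionField 3).integralClosureToAbsIntegers (𝓞 K))).inertia
              (IntermediateField.restrict hle).fixingSubgroup ↔
            (x : W.divisionField 3 ≃ₐ[K] W.divisionField 3) = 1 ∨
              (x : W.divisionField 3 ≃ₐ[K] W.divisionField 3) = ι := by
        intro x
        rw [← Ideal.ramificationSubgroup_zero, mem_ramificationSubgroup_subgroup_iff]
        constructor
        · intro _
          exact (hH x).mp x.2
        · rintro (hx | hx)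
          · rw [hx]; exact Subgroup.one_mem _
          · rw [hx]; exact hι0
      let eqv : ((𝔓.comap ((W.divisionField 3).integralClosureToAbsIntegers (𝓞 K))).inertia
          (IntermediateField.restrict hle).fixingSubgroup) ≃ Bool :=
        { toFun := fun x => if ((x : (IntermediateField.restrict hle).fixingSubgroup) :
              W.divisionField 3 ≃ₐ[K] W.divisionField 3) = 1 then false else true
          invFun := fun b => if b then ⟨⟨ι, hιH⟩, (hset _).mpr (Or.inr rfl)⟩
            else ⟨1, Subgroup.one_mem _⟩
          left_inv := by
            rintro ⟨x, hx⟩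
            rcases (hset x).mp hx with h1 | h1
            · have : x = 1 := Subtype.ext h1
              subst this
              simp
            · have hx1 : (x : W.divisionField 3 ≃ₐ[K] W.divisionField 3) ≠ 1 := by rw [h1]; exact hιne
              simp only [hx1, if_false, if_true]
              congr 1
              exact Subtype.ext h1.symm
          right_inv := by
            rintro (_ | _)
            · simp
            · simp [hιne] }
      rw [Nat.card_congr eqv, Nat.card_eq_fintype_card, Fintype.card_bool]
    haveI : Finite ((𝓞 K) ⧸ 𝔓.under (𝓞 K)) := by
      rw [← h𝔓.2.over]; exact Ideal.finiteQuotientOfFreeOfNeBot v.asIdeal v.ne_bot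
    haveI hsepF : Algebra.IsSeparable
        ((𝓞 K) ⧸ (𝔓.comap ((W.divisionField 3).integralClosureToAbsIntegers (𝓞 K))).under (𝓞 K))
        (integralClosure (𝓞 K) (W.divisionField 3) ⧸
          𝔓.comap ((W.divisionField 3).integralClosureToAbsIntegers (𝓞 K))) :=
      isSeparable_residue_comap (𝓞 K) 𝔓 (W.divisionField 3)
    have he2 : e' = 2 := by
      have hidx := ramificationIdx'_under_eq_card_inertia (𝓞 K) (IntermediateField.restrict hle) (K := K)
        (L := W.divisionField 3) _ hPF0
      rw [he', h𝔓Fr]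
      exact hidx.trans hcardI
    -- identities between the elements
    have hcomp : ∀ r : 𝓞 K,
        algebraMap (integralClosure (𝓞 K) (IntermediateField.restrict hle))
            (integralClosure (𝓞 K) (W.divisionField 3))
            (eR (algebraMap (𝓞 K) (integralClosure (𝓞 K) (W.xDivisionField 3)) r)) =
          algebraMap (𝓞 K) (integralClosure (𝓞 K) (W.divisionField 3)) r := by
      intro r
      apply hinjF
      rw [hjval]
      rfl
    have hinjE : ∀ {X Y : integralClosure (𝓞 K) (W.xDivisionField 3)},
        ((X : W.xDivisionField 3) : AlgebraicClosure K) = ((Y : W.xDivisionField 3) : AlgebraicClosure K) →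
          X = Y :=
      fun h => Subtype.ext (Subtype.ext h)
    have hZE : Z = s₀ ^ 2 - (algebraMap (𝓞 K) (integralClosure (𝓞 K) (W.xDivisionField 3)) c) ^ 2 * Y₀ := by
      apply hinjE
      rw [hZ]
      push_cast
      rw [hs₀, hY₀]
      rfl
    have hw₀sq : w₀ ^ 2 = algebraMap (integralClosure (𝓞 K) (IntermediateField.restrict hle))
        (integralClosure (𝓞 K) (W.divisionField 3)) (eR Y₀) := by
      apply hinjF
      rw [hjval, ← hwsq]
      rfl
    have h3' : w ^ 2 - sF ^ 2 = -(algebraMap (integralClosure (𝓞 K) (IntermediateField.restrict hle))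
        (integralClosure (𝓞 K) (W.divisionField 3)) (eR Z)) := by
      rw [hZE, hw, hsF, ← hcomp c, mul_pow, hw₀sq]
      simp only [map_sub, map_pow, map_mul]
      ring
    have hordw₀ : ord (𝔓.comap ((W.divisionField 3).integralClosureToAbsIntegers (𝓞 K))) w₀ = n₀ := by
      have h := ord_mul _ hPF0 w₀ w₀
      rw [← sq, hw₀sq, htr, hn₀, he2] at h
      have hfin : ord (𝔓.comap ((W.divisionField 3).integralClosureToAbsIntegers (𝓞 K))) w₀ ≠ ⊤ := by
        intro ht
        rw [ht, top_add] at h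
        exact ENat.coe_ne_top (2 * n₀) (by exact_mod_cast h)
      obtain ⟨a, ha⟩ := ENat.ne_top_iff_exists.mp hfin
      rw [← ha] at h ⊢
      have h' : 2 * n₀ = a + a := by exact_mod_cast h
      congr 1
      omega
    have h2w_elt : (2 : integralClosure (𝓞 K) (W.divisionField 3)) * w =
        algebraMap (integralClosure (𝓞 K) (IntermediateField.restrict hle))
          (integralClosure (𝓞 K) (W.divisionField 3))
          (eR (algebraMap (𝓞 K) (integralClosure (𝓞 K) (W.xDivisionField 3)) (2 * c))) * w₀ := by
      rw [hcomp, hw, ← mul_assoc]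
      congr 1
      simp only [map_mul, map_ofNat]
    have h2w : ord (𝔓.comap ((W.divisionField 3).integralClosureToAbsIntegers (𝓞 K))) (2 * w) =
        ((2 * κ + n₀ : ℕ) : ℕ∞) := by
      rw [h2w_elt, ord_mul _ hPF0, htr, hκ, hordw₀, he2]
      push_cast
      ring
    have hsq : ord (𝔓.comap ((W.divisionField 3).integralClosureToAbsIntegers (𝓞 K))) (w ^ 2 - sF ^ 2) =
        ((2 * n : ℕ) : ℕ∞) := by
      rw [h3', ord_neg, htr, hn, he2]
      push_cast
      ring
    have hnF : ((n : ℕ) : integralClosure (𝓞 K) (W.divisionField 3)) ∉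
        𝔓.comap ((W.divisionField 3).integralClosureToAbsIntegers (𝓞 K)) := by
      intro hmem
      apply hnu
      rw [← hcomap, Ideal.mem_comap, map_natCast, h𝔓Fr, Ideal.under_def, Ideal.mem_comap, map_natCast]
      exact hmem
    exact (lowerIndex_eq_of_smul_eq_neg_of_ord_sq_sub_sq hPF0 hι1 hιw hιs h2w hsq hnF).2
  have key := W.card_mul_swanConductorAt_torsion_three_eq_of_roots_divisionPolynomial_three hv2 h3 h𝔓
    hι hι1 hb hcard ne12 ne13 ne14 ne23 ne24 ne34 hΨ
    (hconj · x₂ Z₂ · hZa₂) (hconj · x₃ Z₃ · hZa₃) (hconj · x₄ Z₄ · hZa₄) hn hnu hm₂ hm₃ hm₄ hm₂b hm₃b hm₄b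
  rw [key]

end WeierstrassCurve

end
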